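import Summits.KontsevichZagierPeriods.KontsevichZagierPeriods.Statement
import Summits.KontsevichZagierPeriods.KontsevichZagierPeriods.Theorems.TorsionLogsNeronTorsionFlexDuplicationValue
import Summits.KontsevichZagierPeriods.KontsevichZagierPeriods.Theorems.TorsionLogsNeronTorsionFlexHeightChain
import HarnessLib

/-!
# Route `TorsionLogs`, crux `NeronTorsionFlex` (stmt-KontsevichZagierPeriods-13806) — the rung of line
# `NeronDuplication` as a Theorems-side object, with its landed on-path lemma made visible to automation

The line `NeronDuplication` (registered skeleton `Cruxes/NeronTorsionFlex/Lines/NeronDuplication.lean`,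
stubs `stub_neronDuplicationChain` (the RUNG, XL) and `stub_flexTorsionProduct` (M), composition
`NeronTorsionFlex_of` proved) types its rung as the crux-workfile constant
`Cruxes.NeronTorsionFlex.NeronDuplication.NeronDuplicationChain`: the Néron duplication formula as an
explicit Kontsevich–Zagier chain for an ARBITRARY real point `P` of the identity component of
`y² = 4x³ − g₂x − g₃` (the torsion hypothesis of the proved floor `NeronTorsionPrimitiveChain` dropped).

Theorems files cannot import crux workfiles, so the on-path lander's UNCONDITIONAL proof of the forward
discipline's F4 lemma `S → Rung` (`neronDuplicationChain_of_kontsevichZagierPeriods`, file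
`TorsionLogsNeronTorsionFlexDuplicationValue.lean`, p181181; value identity
`neronDuplication_value_identity` from the tree's real `σ/ζ/℘` theory, parts p181025/p181034/p181070) had to
conclude the rung's 20-line BODY.  This file gives the rung its Theorems-side NAME and states that lemma by
name:

* `NeronDuplicationRung : Prop` — verbatim the body of `…Lines/NeronDuplication.lean`'s
  `NeronDuplicationChain` (one statement for the stub `stub_neronDuplicationChain`, as in the other
  `…Defs.lean` files of this summit); definitionally equal to the crux-workfile constant.
* `neronDuplicationRung_of_kontsevichZagierPeriods : KontsevichZagierPeriods → NeronDuplicationRung` — the F4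
  on-path lemma BY NAME, registered as an `aesop` **safe forward rule**.  Effect: whenever a goal carries
  `h : KontsevichZagierPeriods`, `aesop` adds `NeronDuplicationRung` to the context, and its built-in
  `assumption` rule (default transparency) then closes every goal that is *definitionally* this rung — in
  particular the crux-workfile constant `NeronDuplication.NeronDuplicationChain`, which no Theorems-side rule
  can name.  So the tribunal kernel's forward probe `KontsevichZagierPeriods → NeronDuplicationChain` on the
  UNCHANGED crux file closes by its portfolio tactic `intro h; aesop` as soon as this module is in the probe's
  environment (an apply rule would not do: apply rules are indexed on the conclusion, and the opaque crux
  constant is not this one; a forward rule concluding the raw body would not do either: `aesop`'s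
  normalisation `simp` rewrites the body out of definitional reach — both checked, lander notes fwd2-land-3-g5).
  The rule only ever adds one constant to a context that already assumes the Statement; nothing concluding
  the Statement is tagged.

The `example`s are the kernel's literal forward goal for this name and the delta sanity check against the
body-concluding theorem.

prover-fwd2-land-3-g5-0 (on-path lander, gen 5), 2026-08-19.
-/

-- single-conjunct summit: Sub = Summit, so the namespace segment repeats by design (CONVENTIONS §2)
set_option linter.dupNamespace false

namespace Summit.KontsevichZagierPeriods.KontsevichZagierPeriods.TorsionLogs.NeronDuplication

open Literature.NumberTheory.Transcendental

/-- **The rung of line `NeronDuplication` (Néron duplication chain), Theorems-side name.**  For every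
real Weierstrass curve `f(x) = 4x³ − g₂x − g₃` with `Δ ≠ 0`, largest real root `e₁ > 0` of `f`, every point
`P` of the identity component (`x_P > e₁`) with double `2P` (tangent abscissa
`x_R = (12x_P² − g₂)²/(16 f(x_P)) − 2x_P > e₁`), and every choice of the four integral representations
`rI = ∫∫_{e₁<x′<x<x_P} x′/(√f√f)`, `rJ` (the same up to `x_R`), `rU = ∫∫_{x>x_P, x′>e₁}`, `rP = ∫∫_{x,x′>e₁}`
of `(√f(x))⁻¹ (g₂x′ + 2g₃)/(2x′²√f(x′))`, there are `c ∈ ℤ`, an algebraic `B > 1` with `B^c = f(x_P)²/D³`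
(`D = 3e₁² − g₂/4`) and a representation `rB = ∫_1^B dt/t` such that
`4•[rJ] − 16•[rI] + 4•[rU] − 3•[rP] + c•[rB] ∈ KZ.relations`.
Verbatim the body of `Cruxes.NeronTorsionFlex.NeronDuplication.NeronDuplicationChain` (stub
`stub_neronDuplicationChain` of the registered skeleton of stmt-KontsevichZagierPeriods-13806). -/
def NeronDuplicationRung : Prop :=
  ∀ (g₂ g₃ e₁ xP xR : ℝ) (f : ℝ → ℝ),
    (∀ x, f x = 4 * x ^ 3 - g₂ * x - g₃) → g₂ ^ 3 - 27 * g₃ ^ 2 ≠ 0 → f e₁ = 0 → 0 < e₁ →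
    (∀ x, e₁ < x → 0 < f x) → e₁ < xP →
    xR = (12 * xP ^ 2 - g₂) ^ 2 / (16 * f xP) - 2 * xP → e₁ < xR →
    ∀ (rI rJ rU rP : KZ.IntegralRep 2),
      rI.domain = {z | e₁ < z 1 ∧ z 1 < z 0 ∧ z 0 < xP} →
      Set.EqOn rI.integrand (fun z => z 1 / (Real.sqrt (f (z 1)) * Real.sqrt (f (z 0)))) rI.domain →
      rJ.domain = {z | e₁ < z 1 ∧ z 1 < z 0 ∧ z 0 < xR} →
      Set.EqOn rJ.integrand (fun z => z 1 / (Real.sqrt (f (z 1)) * Real.sqrt (f (z 0)))) rJ.domain →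
      rU.domain = {z | xP < z 0 ∧ e₁ < z 1} →
      Set.EqOn rU.integrand
        (fun z => (Real.sqrt (f (z 0)))⁻¹ * ((g₂ * z 1 + 2 * g₃) / (2 * (z 1) ^ 2 * Real.sqrt (f (z 1))))) rU.domain →
      rP.domain = {z | e₁ < z 0 ∧ e₁ < z 1} →
      Set.EqOn rP.integrand
        (fun z => (Real.sqrt (f (z 0)))⁻¹ * ((g₂ * z 1 + 2 * g₃) / (2 * (z 1) ^ 2 * Real.sqrt (f (z 1))))) rP.domain →
      ∃ (c : ℤ) (B : ℝ) (rB : KZ.IntegralRep 1), 1 < B ∧ IsAlgebraic ℚ B ∧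
        B ^ c = (f xP) ^ 2 / (3 * e₁ ^ 2 - g₂ / 4) ^ 3 ∧
        rB.domain = {t | 1 < t 0 ∧ t 0 < B} ∧ Set.EqOn rB.integrand (fun t => (t 0)⁻¹) rB.domain ∧
        (4 : ℤ) • KZ.of rJ - (16 : ℤ) • KZ.of rI + (4 : ℤ) • KZ.of rU - (3 : ℤ) • KZ.of rP + c • KZ.of rB
          ∈ KZ.relations

/-- **F4 on-path lemma, by name: the Statement implies the rung.**  `KontsevichZagierPeriods →
NeronDuplicationRung`, i.e. `neronDuplicationChain_of_kontsevichZagierPeriods` read through the definition;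
an `aesop` safe forward rule (see the module docstring for what that buys the tribunal kernel). -/
@[aesop safe forward]
theorem neronDuplicationRung_of_kontsevichZagierPeriods (hS : KontsevichZagierPeriods) :
    NeronDuplicationRung :=
  neronDuplicationChain_of_kontsevichZagierPeriods hS

/- The tribunal kernel's literal forward goal for this name, closed by its literal portfolio tactic. -/
example : KontsevichZagierPeriods → NeronDuplicationRung := by
  intro h; aesop

/- Delta sanity: the named rung IS the body concluded by the landed theorem. -/
example (hS : KontsevichZagierPeriods) : NeronDuplicationRung :=
  (neronDuplicationChain_of_kontsevichZagierPeriods hS :)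

end Summit.KontsevichZagierPeriods.KontsevichZagierPeriods.TorsionLogs.NeronDuplication

/-!
## Line `NeronHeight` (registered 2026-08-19, skeleton `Cruxes/NeronTorsionFlex/Lines/NeronHeight.lean`)

The second line on this crux types its rung as the crux-workfile constant
`Cruxes.NeronTorsionFlex.NeronHeight.NeronTorsionHeightChain`: the PROVED floor `NeronTorsionPrimitiveChain`
(`Cruxes.NeronTorsionSector.Translation.stub_assembly`) with the log carrier PINNED to division-polynomial
data, `4N(N−2)·c·log B = q²·(4·log|ψ_{N−1}(x_P, y_P/2)| − N(N−2)·log(3e₁² − g₂/4))`.  Its 20-line body is a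
THEOREM (`TorsionLogs.NeronHeight.neronTorsion_height_chain`, file `TorsionLogsNeronTorsionFlexHeightChain.lean`,
from the value identity `TorsionLogs.NeronHeight.neronTorsion_value_identity`, file
`TorsionLogsNeronTorsionFlexTorsionValue.lean`), so the forward discipline's F4 lemma `S → Rung` holds with
the summit hypothesis idle.  As for line `NeronDuplication` above, this section gives the rung its
Theorems-side NAME and registers the by-name lemma as an `aesop` safe forward rule keyed on the Statement
(the tribunal kernel's forward probe `KontsevichZagierPeriods → NeronTorsionHeightChain` on the unchanged
crux file then closes by `intro h; aesop` whenever this module is in scope).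

prover-fwd2-land-3-g8-0 (on-path lander, gen 8), 2026-08-19.
-/

namespace Summit.KontsevichZagierPeriods.KontsevichZagierPeriods.TorsionLogs.NeronHeight

open Literature.NumberTheory.Transcendental

/-- **The rung of line `NeronHeight` (Néron–torsion chain with pinned carrier), Theorems-side name.**
For every real Weierstrass curve `f(x) = 4x³ − g₂x − g₃` with `Δ ≠ 0`, largest real root `e₁ > 0`, every
real `N`-torsion point `P = (x_P, y_P/2)` of the identity component (`x_P > e₁`, `N ≥ 3`) whose real
elliptic logarithm is `(a/N)·Ω₀` (`0 < a < N/2`), coprime `p, q` with `q(N − 2a) = 2Np`, and the floor's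
representations `rI = ∫∫_{e₁<x′<x<x_P} x′/(√f√f)`, `rP = ∫∫_{x,x′>e₁} (√f(x))⁻¹(g₂x′+2g₃)/(2x′²√f(x′))`,
there are `c ∈ ℤ`, an algebraic `B > 1` and `rB = ∫_1^B dt/t` with
`q²•[rI] + p²•[rP] − c•[rB] ∈ KZ.relations` and
`4N(N−2)·c·log B = q²·(4·log|ψ_{N−1}(x_P, y_P/2)| − N(N−2)·log(3e₁² − g₂/4))`.
Verbatim the body of `Cruxes.NeronTorsionFlex.NeronHeight.NeronTorsionHeightChain` (stub
`stub_neronTorsionHeightChain` of the registered skeleton of stmt-KontsevichZagierPeriods-13806). -/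
def NeronTorsionHeightRung : Prop :=
  ∀ (g₂ g₃ e₁ xP yP : ℝ) (N a p q : ℕ) (f : ℝ → ℝ), (∀ x, f x = 4 * x ^ 3 - g₂ * x - g₃) →
    g₂ ^ 3 - 27 * g₃ ^ 2 ≠ 0 → f e₁ = 0 → 0 < e₁ → (∀ x, e₁ < x → 0 < f x) → e₁ < xP →
    yP ^ 2 = f xP → 3 ≤ N → 0 < a → 2 * a < N →
    (∀ hns : (⟨0, 0, 0, -g₂ / 4, -g₃ / 4⟩ : WeierstrassCurve ℝ).toAffine.Nonsingular xP (yP / 2),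
      addOrderOf (WeierstrassCurve.Affine.Point.some xP (yP / 2) hns) = N) →
    (N : ℝ) * (∫ x in Set.Ioi xP, (Real.sqrt (f x))⁻¹) =
      a * (2 * ∫ x in Set.Ioi e₁, (Real.sqrt (f x))⁻¹) →
    Nat.Coprime p q → (q : ℤ) * ((N : ℤ) - 2 * (a : ℤ)) = (p : ℤ) * (2 * (N : ℤ)) →
    ∀ (rI rP : KZ.IntegralRep 2),
      rI.domain = {z | e₁ < z 1 ∧ z 1 < z 0 ∧ z 0 < xP} →
      Set.EqOn rI.integrand (fun z => z 1 / (Real.sqrt (f (z 1)) * Real.sqrt (f (z 0)))) rI.domain →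
      rP.domain = {z | e₁ < z 0 ∧ e₁ < z 1} →
      Set.EqOn rP.integrand
        (fun z => (Real.sqrt (f (z 0)))⁻¹ * ((g₂ * z 1 + 2 * g₃) / (2 * (z 1) ^ 2 * Real.sqrt (f (z 1)))))
        rP.domain →
      ∃ (c : ℤ) (B : ℝ) (rB : KZ.IntegralRep 1), 1 < B ∧ IsAlgebraic ℚ B ∧
        rB.domain = {t | 1 < t 0 ∧ t 0 < B} ∧ Set.EqOn rB.integrand (fun t => (t 0)⁻¹) rB.domain ∧
        ((q : ℤ) ^ 2) • KZ.of rI + ((p : ℤ) ^ 2) • KZ.of rP - c • KZ.of rB ∈ KZ.relations ∧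
        4 * (N : ℝ) * ((N : ℝ) - 2) * ((c : ℝ) * Real.log B) =
          (q : ℝ) ^ 2 * (4 * Real.log
              |((⟨0, 0, 0, -g₂ / 4, -g₃ / 4⟩ : WeierstrassCurve ℝ).ψ ((N : ℤ) - 1)).evalEval xP (yP / 2)|
            - (N : ℝ) * ((N : ℝ) - 2) * Real.log (3 * e₁ ^ 2 - g₂ / 4))

/-- **The rung of line `NeronHeight` holds** (by name): `neronTorsion_height_chain` read through the
definition. [cite: Silverman1994, Thm VI.3.2] -/
theorem neronTorsionHeightRung_holds : NeronTorsionHeightRung :=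
  neronTorsion_height_chain

/-- **F4 on-path lemma, by name: the Statement implies the rung of line `NeronHeight`.**
`KontsevichZagierPeriods → NeronTorsionHeightRung` (the hypothesis is idle — the rung is a theorem); an
`aesop` safe forward rule keyed on the Statement (see the section docstring). -/
@[aesop safe forward]
theorem neronTorsionHeightRung_of_kontsevichZagierPeriods (_hS : KontsevichZagierPeriods) :
    NeronTorsionHeightRung :=
  neronTorsionHeightRung_holds

/- The tribunal kernel's literal forward goal for this name, closed by its literal portfolio tactic. -/
example : KontsevichZagierPeriods → NeronTorsionHeightRung := by
  intro h; aesop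

/- Delta sanity: the named rung IS the body concluded by the landed theorem. -/
example (hS : KontsevichZagierPeriods) : NeronTorsionHeightRung :=
  (neronTorsionHeightChain_of_kontsevichZagierPeriods hS :)

end Summit.KontsevichZagierPeriods.KontsevichZagierPeriods.TorsionLogs.NeronHeight
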